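import Literature.AnabelianGeometry.SemiGraphs.TemperedPiLevelCosetIso
import Literature.AnabelianGeometry.SemiGraphs.TemperedPiPointSeqFibreIso
import Literature.AnabelianGeometry.SemiGraphs.TemperedPiFibreMap
import Literature.AnabelianGeometry.SemiGraphs.TemperedPiQuotientFibre
import Mathlib.Tactic.Group
import HarnessLib

/-!
# The finite-level kernel `ker π_n` is the stabiliser of the base point of `(𝒢_{S n})_{v₀}` under the
# `π₁^temp`-action ([SemiAnbd] Prop 3.6 p. 38)

Mochizuki, *Semi-graphs of anabelioids*, Publ. RIMS **42** (2006), §3 p. 38 ("`π̂₁(G) = lim Gal(G_i/G)` …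
`Gal(G_{∞,i}/G) → Gal(G_i/G)`"), Prop 3.6 (ii) (the fibre functor) [cite: MochizukiSemiAnbd2006, Prop 3.6 p.38].

PROOF-ONLY file (no definitions; seat abc-iut-L3-t9, Galois-tower lineage; E1 junction of the abc-iut
cell's row T54-B, piece L1 of sub-row (J2d)).  For Galois level data `D` whose levels split themselves
and are connected, the finite-level action `π_n : π₁^temp(𝒢) → Aut(𝒢_{S n})` (abc-iut-L3-d4's
`piLevelAut = descAut ∘ ρ_n`) is read on the `v₀`-fibre of the FINITE level: for the base point
`x_n ∈ (𝒢_{S n})_{v₀}` (the image of `bp_n` under `𝒢_{∞,n} → 𝒢_{S n}`),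

* `levelProj_fV_bp` — `levelProj (bp_n) = x_n` (definitional);
* `piLevelAut_fV_x` — `π_n(γ) (x_n) = γ⁻¹ · x_n` for the fibre-functor action `piAct` on `(𝒢_{S n})_{v₀}`
  (descent square `descAut_sq` + equivariance `piAct_map` of `levelProj` + abc-iut-L3-t8's `proj_fV_bp`);
* **`mem_ker_piLevelAut_iff_piAct_x`** — `γ ∈ ker π_n ↔ γ · x_n = x_n` (rigidity of the connected level:
  an automorphism fixing one point is the identity, `CovObj.aut_eq_of_fV_eq`): the finite-level kernel IS
  the `π₁^temp`-stabiliser of the base point of `(𝒢_{S n})_{v₀}` — so when the level is built with a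
  PRESCRIBED stabiliser (`GaloisLevelData.ofOpenNormalSeq`, `GaloisLevelDataOfOpenNormal.lean`) the
  kernel `ker π_n` is read off that stabiliser through the chart's profinite completion (piece L2/L3 of
  (J2d)).

Nothing here refers to the IUT corpus; no side is taken on [IUTchIII] Cor 3.12; typed ≠ proved.
-/

namespace Literature.AnabelianGeometry.SemiGraphs

namespace ProfiniteSemiGraph

namespace GaloisLevelData

open CategoryTheory

universe u

variable {𝒢 : ProfiniteSemiGraph.{u}} (D : GaloisLevelData 𝒢) (h𝒢 : 𝒢.IsCountable)
  (hconn : ∀ (n : ℕ) (p q : (D.S n).Point), (D.S n).SameComponent p q)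
  (hS : ∀ n, (D.S n).Splits (D.S n)) (n : ℕ)

/-- The covering map `𝒢_{∞,n} → 𝒢_{S n}` sends the base point `bp_n` to the base point `x_n` of the tower
(definitional). [cite: MochizukiSemiAnbd2006, Prop 3.6 p.38] -/
theorem levelProj_fV_bp : ((D.levelProj h𝒢 n).fV D.v₀).hom.hom (D.bp n) = D.x n := rfl

include hS in
/-- `S k` (`k ≥ n`) splits every component object of the level `𝒢_{S n}` (levels split themselves).
[cite: MochizukiSemiAnbd2006, Prop 3.6 p.38] -/
theorem splits_level_component (p : (D.S n).Point) (k : ℕ) (hk : n ≤ k) :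
    (D.S k).Splits ((D.S n).component p) :=
  D.splits_of_le hk (CovObj.Splits.of_hom_right ((D.S n).componentι p)
    (fun _ _ _ hab => Subtype.ext hab) (fun _ _ _ hab => Subtype.ext hab) (hS n))

include hS in
/-- `S k` (`k ≥ n`) splits every component object of `𝒢_{∞,n}`. [cite: MochizukiSemiAnbd2006, Prop 3.6 p.38] -/
theorem splits_cover_component' (p : (D.cover h𝒢 n).Point) (k : ℕ) (hk : n ≤ k) :
    (D.S k).Splits ((D.cover h𝒢 n).component p) :=
  D.splits_of_le hk (CovObj.Splits.of_hom_right ((D.cover h𝒢 n).componentι p)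
    (fun _ _ _ hab => Subtype.ext hab) (fun _ _ _ hab => Subtype.ext hab) (D.splits_cover h𝒢 n (hS n)))

variable (lev : ((D.S n).SV D.v₀).obj.V → ℕ)
  (hlev : ∀ (s : ((D.S n).SV D.v₀).obj.V) (m : ℕ), lev s ≤ m →
    (D.S m).Splits ((D.S n).component (Sum.inl ⟨D.v₀, s⟩)))

include hS in
/-- **`π_n(γ)` moves the base point `x_n` to `γ⁻¹ · x_n`** for the `π₁^temp`-action `piAct` on the
`v₀`-fibre of the finite level (any admissible level function). [cite: MochizukiSemiAnbd2006, Prop 3.6 p.38] -/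
theorem piLevelAut_fV_x (γ : D.temperedPi h𝒢) :
    ((D.piLevelAut h𝒢 hconn n γ).hom.fV D.v₀).hom.hom (D.x n) = D.piAct h𝒢 (D.S n) lev hlev γ⁻¹ (D.x n) := by
  have hn := D.splits_cover_component' h𝒢 hS n (Sum.inl ⟨D.v₀, D.bp n⟩) n le_rfl
  -- the descent square at `bp_n`
  have hsq := congrArg (fun φ => (φ.fV D.v₀).hom.hom (D.bp n))
    (D.descAut_sq h𝒢 hconn n (D.projAut h𝒢 n γ))
  change ((D.levelProj h𝒢 n).fV D.v₀).hom.hom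
      (((D.projAut h𝒢 n γ).hom.fV D.v₀).hom.hom (D.bp n)) =
    ((D.piLevelAut h𝒢 hconn n γ).hom.fV D.v₀).hom.hom (((D.levelProj h𝒢 n).fV D.v₀).hom.hom (D.bp n)) at hsq
  rw [D.levelProj_fV_bp h𝒢 n] at hsq
  rw [← hsq, D.projAut_apply, D.proj_fV_bp h𝒢 n hn (fun _ => n)
    (fun s k hk => D.splits_cover_component' h𝒢 hS n (Sum.inl ⟨D.v₀, s⟩) k hk) γ]
  exact D.piAct_map h𝒢 (D.levelProj h𝒢 n) (fun _ => n)
    (fun s k hk => D.splits_cover_component' h𝒢 hS n (Sum.inl ⟨D.v₀, s⟩) k hk) lev hlev γ⁻¹ (D.bp n)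

include hS in
/-- **`ker π_n` is the stabiliser of the base point `x_n` of `(𝒢_{S n})_{v₀}`** under the `π₁^temp`-action:
`γ ∈ ker π_n ↔ γ · x_n = x_n` (rigidity: an automorphism of the connected level fixing a point is the
identity). [cite: MochizukiSemiAnbd2006, Prop 3.6 p.38] -/
theorem mem_ker_piLevelAut_iff_piAct_x (γ : D.temperedPi h𝒢) :
    γ ∈ (D.piLevelAut h𝒢 hconn n).ker ↔ D.piAct h𝒢 (D.S n) lev hlev γ (D.x n) = D.x n := by
  -- `γ · x = x ↔ γ⁻¹ · x = x`
  have hinv : D.piAct h𝒢 (D.S n) lev hlev γ (D.x n) = D.x n ↔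
      D.piAct h𝒢 (D.S n) lev hlev γ⁻¹ (D.x n) = D.x n := by
    constructor
    · intro h
      have h2 := congrArg (D.piAct h𝒢 (D.S n) lev hlev γ⁻¹) h
      rwa [← D.piAct_mul, inv_mul_cancel, D.piAct_one, eq_comm] at h2
    · intro h
      have h2 := congrArg (D.piAct h𝒢 (D.S n) lev hlev γ) h
      rwa [← D.piAct_mul, mul_inv_cancel, D.piAct_one, eq_comm] at h2
  rw [hinv, MonoidHom.mem_ker, ← D.piLevelAut_fV_x h𝒢 hconn hS n lev hlev γ]
  constructor
  · intro h
    rw [h]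
    rfl
  · intro h
    exact CovObj.aut_eq_of_fV_eq (D.S n) (hconn n) (D.x n) (h.trans rfl)

include hS in
/-- Subgroup form: `ker π_n = {γ | γ · x_n = x_n}`. [cite: MochizukiSemiAnbd2006, Prop 3.6 p.38] -/
theorem ker_piLevelAut_eq_setOf_piAct_x :
    ((D.piLevelAut h𝒢 hconn n).ker : Set (D.temperedPi h𝒢)) =
      {γ | D.piAct h𝒢 (D.S n) lev hlev γ (D.x n) = D.x n} :=
  Set.ext fun γ => D.mem_ker_piLevelAut_iff_piAct_x h𝒢 hconn hS n lev hlev γ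

end GaloisLevelData

end ProfiniteSemiGraph

end Literature.AnabelianGeometry.SemiGraphs

-- build-queue re-enqueue (comment-only re-land by abc-iut-w4-d014 g7, 2026-08-26T10:4xZ): declarations byte-identical to the
-- accepted tree copy (sha16 17db5ca51f53d639); purpose: produce the missing olean (stranded accept) so that PENDING children deferred «no-olean» can verify.
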